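import Literature.Probability.LatticeModels.ThermodynamicLimit
import HarnessLib

/-!
# Boxes converge to `ℤ^d` in the sense of van Hove — proofs

Trunk: StatMech. Companion ("Proofs") file of
`Literature/Probability/LatticeModels/ThermodynamicLimit.lean`: it discharges the named facts
`Literature.Probability.LatticeModels.tendsto_box_vanHove`, `Literature.Probability.LatticeModels.vanHove_neBot` and
`Literature.Probability.LatticeModels.HasVanHoveLimit.hasBoxLimit` of that file (users holding `(h : X)` are fed
`X_holds`). The remaining fact of that file, `Literature.Probability.LatticeModels.eventually_subset_box`, is already
discharged as `Literature.Probability.LatticeModels.eventually_subset_box_holds` in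
`Literature/Probability/LatticeModels/GKSInequalities.lean`.

## Contents (all proved)

* `Literature.Probability.LatticeModels.outerBoundary_box_subset`: `∂ᵉˣ B(L) ⊆ B(L+1) \ B(L)` (a neighbour of a point
  of `B(L)` differs from it by a unit coordinate vector).
* `Literature.Probability.LatticeModels.card_outerBoundary_box_add_le`: `|∂ᵉˣ B(L)| + (2L+1)^d ≤ (2L+3)^d`.
* `Literature.Probability.LatticeModels.tendsto_box_vanHove_holds` — **discharge of `tendsto_box_vanHove`**
  (Friedli–Velenik 2017, §3.2.1, Exercise 3.1 `B(n) ⇑ ℤ^d`, solved in Appendix C): every finite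
  `K` lies in `B(L)` eventually (`iUnion_coe_box`, `box_mono`), and
  `|∂ᵉˣ B(L)| / |B(L)| ≤ (1 + 2/(2L+1))^d - 1 → 0`.
* `Literature.Probability.LatticeModels.vanHove_neBot_holds` (immediate corollary, proof preserved in a comment of the
  main file).
* `Literature.Probability.LatticeModels.HasVanHoveLimit.hasBoxLimit_holds` — **discharge of
  `HasVanHoveLimit.hasBoxLimit`**: a van Hove limit is a limit along boxes
  (`h.comp (tendsto_box_vanHove_holds d)`).

Remark on conventions. The book defines `Λ_n ⇑ ℤ^d` through the *inner* boundary,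
`|∂ⁱⁿΛ_n| / |Λ_n| → 0` (eq. (3.3)), for increasing exhausting sequences; the filter `vanHove d`
of the main file uses the *outer* boundary and "eventually `K ⊆ Λ`". On `ℤ^d` every vertex has
`2d` neighbours, so `|∂ᵉˣΛ| ≤ 2d |∂ⁱⁿΛ|` and `|∂ⁱⁿΛ| ≤ 2d |∂ᵉˣΛ|`, and the two notions agree;
for boxes the printed solution (`|∂ⁱⁿB(n)| = (2n+1)^d - (2n-1)^d`) is replaced here by the
equally elementary `|∂ᵉˣB(n)| ≤ |B(n+1)| - |B(n)| = (2n+3)^d - (2n+1)^d`.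

## References

* S. Friedli, Y. Velenik, *Statistical Mechanics of Lattice Systems: A Concrete Mathematical
  Introduction*, Cambridge University Press (2017), §3.2.1 (convergence in the sense of
  van Hove, eq. (3.3), the boxes `B(n)`, Exercise 3.1) and Appendix C (solution of
  Exercise 3.1). doi:10.1017/9781316882603. [cite: FriedliVelenik2017, §3.2.1 Exercise 3.1]
-/

namespace Literature.Probability.LatticeModels

open Finset Filter Topology

variable {d : ℕ}

/-- The outer boundary of the box `B(L)` lies in the shell `B(L+1) \ B(L)`: a neighbour of a
point of `B(L)` differs from it by a unit coordinate vector. (Friedli–Velenik 2017, §3.2.1,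
solution of Exercise 3.1.) [cite: FriedliVelenik2017, §3.2.1 Exercise 3.1] -/
theorem outerBoundary_box_subset (d L : ℕ) :
    outerBoundary (zdGraph d) (box d L) ⊆ box d (L + 1) \ box d L := by
  intro x hx
  rw [mem_outerBoundary_iff] at hx
  obtain ⟨hxL, y, hy, hadj⟩ := hx
  refine Finset.mem_sdiff.2 ⟨?_, hxL⟩
  rw [mem_box] at hy ⊢
  obtain ⟨i, h | h⟩ := (zdGraph_adj_iff x y).1 hadj
  · intro j
    have hj := hy j
    rw [h] at hj
    simp only [Pi.add_apply, Pi.single_apply] at hj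
    split_ifs at hj <;> push_cast <;> omega
  · subst h
    intro j
    have hj := hy j
    simp only [Pi.add_apply, Pi.single_apply]
    split_ifs <;> push_cast <;> omega

/-- `|∂ᵉˣ B(L)| + |B(L)| ≤ |B(L+1)|`, i.e. `|∂ᵉˣ B(L)| ≤ (2L+3)^d - (2L+1)^d`.
(Friedli–Velenik 2017, §3.2.1, solution of Exercise 3.1.) [cite: FriedliVelenik2017, §3.2.1 Exercise 3.1] -/
theorem card_outerBoundary_box_add_le (d L : ℕ) :
    #(outerBoundary (zdGraph d) (box d L)) + (2 * L + 1) ^ d ≤ (2 * L + 3) ^ d := by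
  have h := card_le_card (outerBoundary_box_subset d L)
  rw [card_sdiff_of_subset (box_mono d (Nat.le_succ L)), card_box, card_box] at h
  have hmono : (2 * L + 1) ^ d ≤ (2 * (L + 1) + 1) ^ d := Nat.pow_le_pow_left (by omega) d
  have e : 2 * (L + 1) + 1 = 2 * L + 3 := by ring
  rw [e] at h hmono
  omega

/-- **Discharge of `tendsto_box_vanHove`**: the boxes `B(L)` converge to `ℤ^d` in the sense of
van Hove. (Friedli–Velenik 2017, §3.2.1, Exercise 3.1 and its solution in Appendix C.) [cite: FriedliVelenik2017, §3.2.1 Exercise 3.1] -/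
theorem tendsto_box_vanHove_holds : tendsto_box_vanHove := by
  intro d
  rw [tendsto_vanHove_iff]
  intro ε hε K
  -- every finite `K` is eventually inside the boxes
  have hK : ∀ᶠ L in atTop, K ⊆ box d L := by
    have hx : ∀ x ∈ K, ∀ᶠ L in atTop, x ∈ box d L := by
      intro x _
      have hxU : x ∈ ⋃ L : ℕ, ((box d L : Finset (Site d)) : Set (Site d)) := by
        rw [iUnion_coe_box]; trivial
      obtain ⟨L₀, hL₀⟩ := Set.mem_iUnion.1 hxU
      rw [Finset.mem_coe] at hL₀
      exact eventually_atTop.2 ⟨L₀, fun L hL => box_mono d hL hL₀⟩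
    exact ((eventually_all_finset K).2 hx).mono fun L h x hx' => h x hx'
  -- `(1 + 2/(2L+1))^d → 1`
  have h0 : Tendsto (fun L : ℕ => 2 * (L : ℝ) + 1) atTop atTop :=
    tendsto_atTop_mono (fun L => by linarith [(Nat.cast_nonneg L : (0 : ℝ) ≤ L)])
      tendsto_natCast_atTop_atTop
  have h1 : Tendsto (fun L : ℕ => (2 : ℝ) / (2 * (L : ℝ) + 1)) atTop (𝓝 0) :=
    tendsto_const_nhds.div_atTop h0
  have h2 : Tendsto (fun L : ℕ => (1 + (2 : ℝ) / (2 * (L : ℝ) + 1)) ^ d) atTop (𝓝 1) := by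
    have := ((tendsto_const_nhds (x := (1 : ℝ))).add h1).pow d
    rwa [add_zero, one_pow] at this
  have h3 : ∀ᶠ L : ℕ in atTop, (1 + (2 : ℝ) / (2 * (L : ℝ) + 1)) ^ d < 1 + ε :=
    h2.eventually (gt_mem_nhds (by linarith))
  filter_upwards [hK, h3] with L hKL hL
  refine ⟨hKL, ?_⟩
  have hpos : (0 : ℝ) < 2 * (L : ℝ) + 1 := by positivity
  have hc : (#(outerBoundary (zdGraph d) (box d L)) : ℝ) + (2 * (L : ℝ) + 1) ^ d
      ≤ (2 * (L : ℝ) + 3) ^ d := by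
    exact_mod_cast card_outerBoundary_box_add_le d L
  have key : (2 * (L : ℝ) + 3) ^ d ≤ (1 + ε) * (2 * (L : ℝ) + 1) ^ d := by
    have e : (2 * (L : ℝ) + 3) = (1 + 2 / (2 * (L : ℝ) + 1)) * (2 * (L : ℝ) + 1) := by
      have hne : (2 * (L : ℝ) + 1) ≠ 0 := hpos.ne'
      field_simp
      ring
    rw [e, mul_pow]
    exact mul_le_mul_of_nonneg_right hL.le (by positivity)
  rw [add_mul, one_mul] at key
  rw [card_box]
  push_cast
  linarith

/-- **Discharge of `vanHove_neBot`**: the van Hove filter is nontrivial.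
(Friedli–Velenik 2017, §3.2.1.) [cite: FriedliVelenik2017, §3.2.1] -/
theorem vanHove_neBot_holds : vanHove_neBot := by
  intro d
  exact (tendsto_box_vanHove_holds d).neBot

/-- **Discharge of `HasVanHoveLimit.hasBoxLimit`**: a van Hove limit is in particular a limit
along the boxes `B(L)`, since `B(L) ⇑ ℤ^d` (`tendsto_box_vanHove_holds`).
(Friedli–Velenik 2017, §3.2.1, Exercise 3.1.) [cite: FriedliVelenik2017, §3.2.1 Exercise 3.1] -/
theorem HasVanHoveLimit.hasBoxLimit_holds {α : Type*} [TopologicalSpace α] :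
    HasVanHoveLimit.hasBoxLimit (d := d) (α := α) := by
  intro f a h
  exact Filter.Tendsto.comp h (tendsto_box_vanHove_holds d)

end Literature.Probability.LatticeModels
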